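import Mathlib
import Literature.Barriers.ValiantsHypothesis.AlgebraicNaturalProofs
import Literature.Computability.AlgebraicComplexity.ArithCircuitProofs
import HarnessLib

/-!
# Crux `BarrierLever.SuccinctHittingSetsForVP` (stmt-ValiantsHypothesis-14610), line `registered` —
stub `stub_multilinearBase`: THE MULTILINEAR ALL-ONES BASE POINT

**What is proved (unconditional; a worker-sized stub of the multilinear-slice-relative sparse
half, it does NOT close the item).** In FSV's framework over `ℂ` (tree regime `d = n`, simple class
`SmallCircuits ℂ n b = {f : deg f ≤ n, L(f) ≤ n^b}`, multilinear slice
`multilinearSlice ℂ n = {f : every monomial of f is multilinear}`):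

* `stub_multilinearBase` : for every `n ≥ 2` the polynomial `P = ∏_i (1 + x_i)` lies in
  `SmallCircuits ℂ n 2` (degree `≤ n`, fan-in-two size `≤ 2n ≤ n²`), is multilinear, and its
  coefficient at `x^μ` is `1` if `μ` is multilinear (`μ_i ≤ 1` for all `i`) and `0` otherwise.

This is the all-ones shift vector `𝟙 = coeff(∏ (x_i + 1))` of Forbes–Shpilka–Volk's
Construction 29, the base point of the hitting circuits `∏(1 + x_i) + (sparse multilinear
correction)` of the multilinear-slice-relative sparse half of the crux.

**Proof.** `∏_i (1 + x_i) = Σ_{t ⊆ [n]} ∏_{i ∈ t} x_i` (`Finset.prod_one_add`) and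
`∏_{i ∈ t} x_i` is the monomial with exponent vector the indicator of `t`
(`MvPolynomial.prod_X_pow`); distinct `t` give distinct exponents, so the coefficient at `μ` is `1`
iff `μ` is an indicator, i.e. iff `μ` is `{0,1}`-valued. Multilinearity follows from the coefficient
formula; the degree bound from `deg ∏ ≤ Σ deg` and `deg (1 + x_i) ≤ 1`; the size bound from
`L(∏_{i ∈ s} f_i) ≤ Σ L(f_i) + #s`, `L(1 + x_i) ≤ L(1) + L(x_i) + 1 = 1`
(`Literature.Computability.AlgebraicComplexity`). Axioms: `propext`, `Classical.choice`,
`Quot.sound`.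

References: [ForbesShpilkaVolk2018] Construction 29 (the all-ones shift vector), Thm. 9 / Cor. 34;
[Burgisser2000] Def. 2.1, §2.1 (the complexity measure).
-/

-- layout Summits/ValiantsHypothesis/ValiantsHypothesis forces the duplicated namespace component
set_option linter.dupNamespace false

namespace Summit.ValiantsHypothesis.ValiantsHypothesis.Theorems.BarrierLever.SuccinctHittingSetsForVP

open Literature.Barriers.ValiantsHypothesis Literature.Computability.AlgebraicComplexity MvPolynomial

namespace MultilinearBase

variable {n : ℕ}

section Expansion

/-- `∏_i (1 + x_i) = Σ_{t ⊆ [n]} x^{𝟙_t}`: the product expands into the sum of all multilinear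
monomials, one for each subset `t` of the variables. [folklore] -/
theorem prod_one_add_X_eq :
    (∏ i : Fin n, (1 + X i) : MvPolynomial (Fin n) ℂ) =
      ∑ t : Finset (Fin n), monomial (Finsupp.indicator t fun _ _ => 1) 1 := by
  rw [Finset.prod_one_add, Finset.powerset_univ]
  refine Finset.sum_congr rfl fun t _ => ?_
  have h := MvPolynomial.prod_X_pow (R := ℂ) (fun _ : Fin n => 1) t
  simp only [pow_one] at h
  exact h

/-- The indicator exponent vector `𝟙_t` of a subset `t` is `{0,1}`-valued. [folklore] -/
theorem indicator_apply_le_one (t : Finset (Fin n)) (i : Fin n) :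
    (Finsupp.indicator t fun _ _ => (1 : ℕ)) i ≤ 1 := by
  rw [Finsupp.indicator_apply]
  split_ifs <;> omega

/-- The support of the indicator exponent vector `𝟙_t` is `t`. [folklore] -/
theorem support_indicator_one (t : Finset (Fin n)) :
    (Finsupp.indicator t fun _ _ => (1 : ℕ)).support = t := by
  ext i
  rw [Finsupp.mem_support_iff, Finsupp.indicator_apply]
  split_ifs with hi <;> simp [hi]

/-- A `{0,1}`-valued exponent vector is the indicator of its support. [folklore] -/
theorem indicator_support_eq_self {μ : Fin n →₀ ℕ} (h : ∀ i, μ i ≤ 1) :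
    (Finsupp.indicator μ.support fun _ _ => (1 : ℕ)) = μ := by
  ext i
  rw [Finsupp.indicator_apply]
  split_ifs with hi
  · have h1 := h i
    have h2 := Finsupp.mem_support_iff.mp hi
    omega
  · exact (Finsupp.notMem_support_iff.mp hi).symm

end Expansion

section Coefficients

/-- **The coefficient vector of `∏_i (1 + x_i)` is the indicator of the multilinear monomials**:
`coeff_μ ∏_i (1 + x_i) = 1` if `μ_i ≤ 1` for all `i`, and `= 0` otherwise (FSV's all-ones shift
vector `𝟙`). [cite: ForbesShpilkaVolk2018, Construction 29] -/
theorem coeff_prod_one_add_X (μ : Fin n →₀ ℕ) :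
    coeff μ (∏ i : Fin n, (1 + X i) : MvPolynomial (Fin n) ℂ) =
      if ∀ i, μ i ≤ 1 then 1 else 0 := by
  classical
  rw [prod_one_add_X_eq, coeff_sum]
  simp_rw [coeff_monomial]
  by_cases h : ∀ i, μ i ≤ 1
  · rw [if_pos h, Finset.sum_eq_single μ.support]
    · exact if_pos (indicator_support_eq_self h)
    · intro t _ ht
      refine if_neg fun heq => ht ?_
      rw [← heq, support_indicator_one]
    · intro hμ
      exact absurd (Finset.mem_univ _) hμ
  · rw [if_neg h]
    refine Finset.sum_eq_zero fun t _ => if_neg fun heq => h ?_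
    rw [← heq]
    exact indicator_apply_le_one t

/-- `∏_i (1 + x_i)` is multilinear: every monomial in its support is `{0,1}`-valued.
[cite: ForbesShpilkaVolk2018, Construction 29] -/
theorem prod_one_add_X_mem_multilinearSlice :
    (∏ i : Fin n, (1 + X i) : MvPolynomial (Fin n) ℂ) ∈ multilinearSlice ℂ n := by
  simp only [multilinearSlice, Set.mem_setOf_eq]
  intro m hm
  rw [mem_support_iff, coeff_prod_one_add_X] at hm
  by_contra hmi
  exact hm (if_neg hmi)

end Coefficients

section Degree

/-- `deg ∏_i (1 + x_i) ≤ n`. [folklore] -/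
theorem totalDegree_prod_one_add_X_le :
    (∏ i : Fin n, (1 + X i) : MvPolynomial (Fin n) ℂ).totalDegree ≤ n := by
  refine (totalDegree_finsetProd _ _).trans ?_
  have h : ∀ i : Fin n, (1 + X i : MvPolynomial (Fin n) ℂ).totalDegree ≤ 1 := fun i => by
    refine (totalDegree_add _ _).trans (max_le ?_ ?_)
    · rw [totalDegree_one]
      exact Nat.zero_le _
    · exact (totalDegree_X (R := ℂ) i).le
  calc ∑ i : Fin n, (1 + X i : MvPolynomial (Fin n) ℂ).totalDegree ≤ ∑ _i : Fin n, 1 :=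
        Finset.sum_le_sum fun i _ => h i
    _ = n := by rw [Finset.sum_const, Finset.card_univ, Fintype.card_fin, smul_eq_mul, mul_one]

end Degree

section Complexity

/-- `L(∏_i (1 + x_i)) ≤ 2n ≤ n²` for `n ≥ 2`: each factor costs one addition gate (variables and
constants are free) and the product `n` multiplication gates. [cite: Burgisser2000, §2.1] -/
theorem complexity_prod_one_add_X_le (hn : 2 ≤ n) :
    complexity (∏ i : Fin n, (1 + X i) : MvPolynomial (Fin n) ℂ) ≤ n ^ 2 := by
  have hone : complexity (1 : MvPolynomial (Fin n) ℂ) = 0 := by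
    simpa using complexity_C_holds (σ := Fin n) (1 : ℂ)
  have hfac : ∀ i : Fin n, complexity (1 + X i : MvPolynomial (Fin n) ℂ) ≤ 1 := fun i =>
    calc complexity (1 + X i : MvPolynomial (Fin n) ℂ)
        ≤ complexity (1 : MvPolynomial (Fin n) ℂ) +
            complexity (X i : MvPolynomial (Fin n) ℂ) + 1 := complexity_add_le_holds _ _
      _ = 1 := by rw [hone, complexity_X_holds i]
  calc complexity (∏ i : Fin n, (1 + X i) : MvPolynomial (Fin n) ℂ)
      ≤ ∑ i : Fin n, complexity (1 + X i : MvPolynomial (Fin n) ℂ) +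
          (Finset.univ : Finset (Fin n)).card := complexity_finset_prod_le _ _
    _ ≤ ∑ _i : Fin n, 1 + n := by
        rw [Finset.card_univ, Fintype.card_fin]
        exact Nat.add_le_add_right (Finset.sum_le_sum fun i _ => hfac i) n
    _ = 2 * n := by
        rw [Finset.sum_const, Finset.card_univ, Fintype.card_fin, smul_eq_mul, mul_one]
        ring
    _ ≤ n ^ 2 := by nlinarith

end Complexity

end MultilinearBase

open MultilinearBase

/-- **Registered stub `stub_multilinearBase`** (crux stmt-ValiantsHypothesis-14610, line
`registered`; the multilinear all-ones base point, FSV Construction 29's shift vector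
`𝟙 = coeff(∏ (x_i + 1))`): for `n ≥ 2`, `∏_i (1 + x_i)` is a multilinear small circuit (degree
`≤ n`, size `≤ 2n ≤ n²`) whose coefficient vector is the indicator of the multilinear monomials.
[cite: ForbesShpilkaVolk2018, Construction 29] -/
theorem stub_multilinearBase :
    ∀ n : ℕ, 2 ≤ n →
      (∏ i : Fin n, (1 + X i) : MvPolynomial (Fin n) ℂ) ∈ SmallCircuits ℂ n 2 ∧
      (∏ i : Fin n, (1 + X i) : MvPolynomial (Fin n) ℂ) ∈ multilinearSlice ℂ n ∧
      ∀ μ : Fin n →₀ ℕ, MvPolynomial.coeff μ (∏ i : Fin n, (1 + X i) : MvPolynomial (Fin n) ℂ) =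
        if ∀ i, μ i ≤ 1 then 1 else 0 := by
  intro n hn
  exact ⟨⟨totalDegree_prod_one_add_X_le, complexity_prod_one_add_X_le hn⟩,
    prod_one_add_X_mem_multilinearSlice, fun μ => coeff_prod_one_add_X μ⟩

end Summit.ValiantsHypothesis.ValiantsHypothesis.Theorems.BarrierLever.SuccinctHittingSetsForVP
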